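import Literature.IUT.HodgeArakelov.LabelClassesOfCusps

/-!
# [IUTchII] §2 Def 2.3 (ii) / Rmk 2.4.1 — REPAIRED renderings `Def23_ii'`, `Rmk241_openOrTrivial'` (repair file R2)

Second repair file for the LANDED, frozen `LabelClassesOfCusps.lean` (p407174), complementing
`LabelClassesOfCuspsR.lean` (abc-iut-L6-d1: `Cor24_ii_iii'`) under L6-lead's RULING 2026-08-25T21:09:40Z
(repairs live in R-files; the landed module is not edited). Writer abc-iut-L6-t19. S. Mochizuki,
*Inter-universal Teichmüller theory II*, kurims manuscript Dec. 2020, pp. 67–71. Nothing here takes a side on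
[IUTchIII] Cor. 3.12.

* `Def23_ii'` — Def. 2.3 (ii) p. 68 l. 7–9 "the cuspidal inertia groups of `Π_⊇` may be obtained as the
  `Π_⊇`-conjugates of the commensurators [or, alternatively, the normalizers] in `Π_⊇` of the cuspidal inertia
  groups of `Π_⊆` [cf. [CombGC], Proposition 1.2, (ii)]": [CombGC] Prop. 1.2 (ii) is commensurable TERMINALITY
  in the geometric (PSC-type) group, so the normaliser is taken inside `Δ_⊇ := Π_⊇ ∩ Δ̂^cor_v`; in the
  arithmetic `Π_⊇` the normaliser of a cuspidal inertia group is its decomposition group, so the landed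
  `Def23_ii` conjunct 3 fails at the intended model (finding T1-F9, abc-iut-L6-t19; relayed by abc-iut-L6-d3 R4).
* `Rmk241_openOrTrivial'` — Rmk. 2.4.1 p. 71 "every CLOSED subgroup of such a maximal pro-`l'` subgroup is
  either open or trivial" — with the closedness hypothesis the landed `Rmk241_openOrTrivial` dropped
  (finding T1-F3; v1 kernel-refuted at `ℤ_p` and the printed form proved at `ℤ_p` in
  `LabelClassesOfCuspsNegative.lean`, p407862).
-/

namespace Literature.IUT.HodgeArakelov

universe u

variable {S : BadPlaceSetting.{u}} {P : TopGroup.{u}} {T : TemperedCoverings S P}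

/-- **IUTchII:Def2.3(ii)′** (kurims p. 68), repaired third conjunct: for `Π_⊆ ⊆ Π_⊇` among the six groups of
(i), "the cuspidal inertia groups of `Π_⊆` [are] the intersections with `Π_⊆` of those cuspidal inertia groups
of `Π_⊇` that contain a finite index subgroup that lies inside `Π_⊆`", and "the cuspidal inertia groups of `Π_⊇`
[are] the `Π_⊇`-conjugates of the … normalizers … of the cuspidal inertia groups of `Π_⊆` [cf. [CombGC],
Proposition 1.2, (ii)]" — the normaliser being taken, as [CombGC] Prop. 1.2 (ii) (commensurable terminality)
requires, in the GEOMETRIC group `Δ_⊇ := Π_⊇ ∩ Δ̂^cor_v`, where it equals the cuspidal inertia group of `Π_⊇`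
(abelian, containing that of `Π_⊆` with finite index). [cite: Mochizuki2012, Def 2.3 (ii) p.68] -/
def Def23_ii' {W : PlusMinusTower T} (C : CuspidalInertiaData W) (Qsub Qsup : Subgroup W.Corhat) : Prop :=
  Qsub ≤ Qsup ∧
  (∀ I, C.IsCuspidalInertia Qsub I ↔
      ∃ I', C.IsCuspidalInertia Qsup I' ∧ ((I' ⊓ Qsub).subgroupOf I').FiniteIndex ∧ I = I' ⊓ Qsub) ∧
  (∀ I', C.IsCuspidalInertia Qsup I' ↔
      ∃ I, C.IsCuspidalInertia Qsub I ∧ ∃ g ∈ Qsup,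
        I' = ((Subgroup.normalizer ((I.subgroupOf (Qsup ⊓ W.deltaCorHat) :
            Subgroup ↥(Qsup ⊓ W.deltaCorHat)) : Set ↥(Qsup ⊓ W.deltaCorHat))).map
          (Qsup ⊓ W.deltaCorHat).subtype).map (MulAut.conj g).toMonoidHom)

/-- **IUTchII:Rmk2.4.1′** (kurims p. 71), repaired: "every closed subgroup of such a maximal pro-`l'` subgroup
is either open or trivial" — for a subgroup `I'` of a topological group (abstractly `≅ ℤ_{l'}`): every CLOSED
subgroup of `I'` is trivial or of finite index in `I'` (hence open in `I'`). [cite: Mochizuki2012, Rmk 2.4.1 p.71] -/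
def Rmk241_openOrTrivial' {G : Type u} [Group G] [TopologicalSpace G] (I' : Subgroup G) : Prop :=
  ∀ K : Subgroup G, K ≤ I' → IsClosed (K : Set G) → K = ⊥ ∨ (K.subgroupOf I').FiniteIndex

end Literature.IUT.HodgeArakelov
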